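import Summits.CriticalPhenomena.PercolationContinuityZ3.Theorems.PercNearOneGluingNoHeavyLowerTailSahiLatinDescent4
import Summits.CriticalPhenomena.PercolationContinuityZ3.Theorems.PercNearOneGluingNoHeavyLowerTailSahiLatinBridge

/-!
# `NoHeavyLowerTail` (crux stmt-CriticalPhenomena-4575), Sahi programme (prim-master-conj gen 42): the ORDER-4 FULL-POLARISATION BRIDGE
# in EVERY dimension — `K₄ ≥ 0` on up-set 4-tuples of `[4]^d` (equivalently, given FBP(3,d): on the TERMINAL ones) implies Sahi's
# `E₄ ≥ 0` on every product of `d` finite chains with every product probability weight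

Support file (`--supports stmt-CriticalPhenomena-4575`; order-4 analogue of `…SahiLatinBridge`; companion of `…SahiLatinKernel4/Descent4`).
Memo `run/shared/lean/prim/prim-l12/FROM-prim-master-conj-g41-DESCENT.md` §10.

* `sahiE_four_setInd_eq_sum_quad` — for a finite type `P` with a probability weight: `E₄(1_a,1_b,1_c,1_d) = Σ_{t : Fin 4 → P} (Π_j μ(t j))·G₄(t)`
  (four independent copies; Sahi's set-partition form `Literature…sahiE_four`; `Gr4` = real form of `SahiLatin.G4`);
* on `P = Π_i α_i` with a product weight: the axiswise action `actQ` of `(Perm (Fin 4))^ι` on 4-tuples of points, invariance of the weight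
  (`W4_actQ`), orbit averaging (`sum_quad_eq_sum_orbitAvg`), the sorting pull-back `psiQ`/`pullQ` (monotone; up-sets pull back to up-sets of
  `[4]^ι`) and **`orbitSum_eq_kappa4`**: `Σ_π G₄(π·t) = K₄` of the pulled-back 4-tuple;
* **`sahiPositive_four_prodW`**: `LatinPos4 ι` (FBP(4,|ι|)) ⟹ `SahiPositive (prodW w) 4`; marginal form `sahiPositive_four_prodW'`;
* **`sahiPositive_four_of_terminalPos4`**: FBP(3,|ι|) ∧ `TerminalPos4 ι` ⟹ Sahi's `E₄(f₁,…,f₄) ≥ 0` for all nonnegative monotone `fᵢ` on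
  `Π_i α_i` under every product probability weight (order-4 descent theorem `latinPos4_iff_terminalPos4`).
For `ι = Fin 3` (with `LatinPos (Fin 3)` from `…SahiLatinThree`) this reduces "`E₄ ≥ 0` on every product of THREE chains" — open in print
beyond two chains [LiebSahi2022, Thm 3.7] — to the finite statement `TerminalPos4 (Fin 3)`.  Everything here is proved; axioms standard.
-/

namespace Summit.CriticalPhenomena.PercolationContinuityZ3.Theorems.SahiLatin

open Finset Literature.Combinatorics.Sahi2008

/-! ## Four independent copies: `E₄` of indicators as a sum over 4-tuples (any finite type) -/

section Polar4

variable {P : Type*} [Fintype P] [DecidableEq P]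

/-- The weight `Π_j μ (t j)` of a 4-tuple of independent copies. [this work] -/
def W4 (μ : P → ℝ) (t : Fin 4 → P) : ℝ := ∏ j, μ (t j)

/-- The real form of the order-4 integrand `G₄` on a 4-tuple (block of `a` on copy `0`). [this work] -/
def Gr4 (a b c d : Finset P) (t : Fin 4 → P) : ℝ :=
  chi a (t 0) * (6 * (chi b (t 0) * chi c (t 0) * chi d (t 0))
    - 2 * (chi b (t 0) * chi c (t 0) * chi d (t 1) + chi b (t 0) * chi d (t 0) * chi c (t 1) + chi c (t 0) * chi d (t 0) * chi b (t 1)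
        + chi b (t 1) * chi c (t 1) * chi d (t 1))
    - (chi b (t 0) * (chi c (t 1) * chi d (t 1)) + chi c (t 0) * (chi b (t 1) * chi d (t 1)) + chi d (t 0) * (chi b (t 1) * chi c (t 1)))
    + (chi b (t 0) * chi c (t 1) * chi d (t 2) + chi c (t 0) * chi b (t 1) * chi d (t 2) + chi d (t 0) * chi b (t 1) * chi c (t 2)
        + chi b (t 1) * chi c (t 1) * chi d (t 2) + chi b (t 1) * chi d (t 1) * chi c (t 2) + chi c (t 1) * chi d (t 1) * chi b (t 2))
    - chi b (t 1) * chi c (t 2) * chi d (t 3))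

omit [Fintype P] in
/-- `Gr4` is the cast of the integer integrand `G4`. [this work] -/
theorem Gr4_eq_cast (a b c d : Finset P) (t : Fin 4 → P) : Gr4 a b c d t = ((G4 a b c d (t 0) (t 1) (t 2) (t 3) : ℤ) : ℝ) := by
  simp only [Gr4, G4, H4]; push_cast; simp only [cast_ind]

omit [DecidableEq P] in
/-- Four independent copies: `Π_j E_μ(F_j) = Σ_t W(t) Π_j F_j(t_j)`. [this work] -/
theorem prod_ex_eq_sum_quad (μ : P → ℝ) (F : Fin 4 → P → ℝ) :
    ∏ j, ex μ (F j) = ∑ t : Fin 4 → P, W4 μ t * ∏ j, F j (t j) := by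
  simp only [ex]
  rw [Fintype.prod_sum (fun j p => μ p * F j p)]
  refine sum_congr rfl fun t _ => ?_
  rw [W4, ← prod_mul_distrib]

omit [DecidableEq P] in
/-- Four independent copies, explicit form. [this work] -/
theorem prod_ex_four (μ : P → ℝ) (f0 f1 f2 f3 : P → ℝ) :
    ex μ f0 * ex μ f1 * ex μ f2 * ex μ f3 = ∑ t : Fin 4 → P, W4 μ t * (f0 (t 0) * f1 (t 1) * f2 (t 2) * f3 (t 3)) := by
  have := prod_ex_eq_sum_quad μ ![f0, f1, f2, f3]
  rw [Fin.prod_univ_four] at this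
  simp only [Matrix.cons_val_zero, Matrix.cons_val_one, Matrix.cons_val] at this
  rw [this]
  refine sum_congr rfl fun t _ => ?_
  rw [Fin.prod_univ_four]
  simp only [Matrix.cons_val_zero, Matrix.cons_val_one, Matrix.cons_val]

/-- **`E₄` of four indicators as a sum over 4-tuples of independent copies** (probability weight, any finite type). [this work] -/
theorem sahiE_four_setInd_eq_sum_quad (μ : P → ℝ) (hμ : ∑ p, μ p = 1) (a b c d : Finset P) :
    sahiE μ 4 ![setInd a, setInd b, setInd c, setInd d] = ∑ t : Fin 4 → P, W4 μ t * Gr4 a b c d t := by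
  have h1 : ex μ 1 = 1 := ex_one hμ
  -- Sahi's set-partition form, every term padded to a product of four expectations, the block of `a` first
  have key : sahiE μ 4 ![setInd a, setInd b, setInd c, setInd d] =
      6 * (ex μ (chi a * chi b * chi c * chi d) * ex μ 1 * ex μ 1 * ex μ 1)
      - 2 * (ex μ (chi a) * ex μ (chi b * chi c * chi d) * ex μ 1 * ex μ 1 + ex μ (chi a * chi c * chi d) * ex μ (chi b) * ex μ 1 * ex μ 1
          + ex μ (chi a * chi b * chi d) * ex μ (chi c) * ex μ 1 * ex μ 1 + ex μ (chi a * chi b * chi c) * ex μ (chi d) * ex μ 1 * ex μ 1)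
      + (ex μ (chi a) * ex μ (chi c * chi d) * ex μ (chi b) * ex μ 1 + ex μ (chi a) * ex μ (chi b * chi d) * ex μ (chi c) * ex μ 1
          + ex μ (chi a) * ex μ (chi b * chi c) * ex μ (chi d) * ex μ 1 + ex μ (chi a * chi d) * ex μ (chi b) * ex μ (chi c) * ex μ 1
          + ex μ (chi a * chi c) * ex μ (chi b) * ex μ (chi d) * ex μ 1 + ex μ (chi a * chi b) * ex μ (chi c) * ex μ (chi d) * ex μ 1)
      - (ex μ (chi a * chi b) * ex μ (chi c * chi d) * ex μ 1 * ex μ 1 + ex μ (chi a * chi c) * ex μ (chi b * chi d) * ex μ 1 * ex μ 1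
          + ex μ (chi a * chi d) * ex μ (chi b * chi c) * ex μ 1 * ex μ 1)
      - ex μ (chi a) * ex μ (chi b) * ex μ (chi c) * ex μ (chi d) := by
    rw [← chi_eq_setInd, ← chi_eq_setInd, ← chi_eq_setInd, ← chi_eq_setInd, sahiE_four, h1]; ring
  rw [key]
  simp only [prod_ex_four, Pi.mul_apply, Pi.one_apply, mul_one]
  simp only [Gr4, mul_sum, ← sum_add_distrib, ← sum_sub_distrib]
  exact sum_congr rfl fun t _ => by ring

end Polar4

/-! ## Product spaces: the axiswise action of `(Perm (Fin 4))^ι` on 4-tuples of points -/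

section Pi4

variable {ι : Type*} [Fintype ι] [DecidableEq ι] {α : ι → Type*} [∀ i, Fintype (α i)] [∀ i, LinearOrder (α i)]

/-- `π · t` on 4-tuples: on each axis `i`, copy `j` receives the `i`-th coordinate of copy `π i j`. [this work] -/
def actQ (π : LPerm4 ι) (t : Fin 4 → ∀ i, α i) : Fin 4 → ∀ i, α i := fun j i => t (π i j) i

omit [Fintype ι] [DecidableEq ι] [∀ i, Fintype (α i)] [∀ i, LinearOrder (α i)] in
/-- The identity acts trivially. [this work] -/
theorem actQ_one (t : Fin 4 → ∀ i, α i) : actQ (1 : LPerm4 ι) t = t := by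
  funext j i; simp [actQ]

omit [Fintype ι] [DecidableEq ι] [∀ i, Fintype (α i)] [∀ i, LinearOrder (α i)] in
/-- Anti-homomorphism: `(πρ) · t = ρ · (π · t)`. [this work] -/
theorem actQ_mul (π ρ : LPerm4 ι) (t : Fin 4 → ∀ i, α i) : actQ (π * ρ) t = actQ ρ (actQ π t) := by
  funext j i; simp [actQ, Pi.mul_apply, Equiv.Perm.mul_apply]

/-- The action of `π` as a bijection of 4-tuples. [this work] -/
def actQEquiv (π : LPerm4 ι) : (Fin 4 → ∀ i, α i) ≃ (Fin 4 → ∀ i, α i) where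
  toFun := actQ π
  invFun := actQ π⁻¹
  left_inv t := by show actQ π⁻¹ (actQ π t) = t; rw [← actQ_mul, mul_inv_cancel, actQ_one]
  right_inv t := by show actQ π (actQ π⁻¹ t) = t; rw [← actQ_mul, inv_mul_cancel, actQ_one]

omit [DecidableEq ι] [∀ i, Fintype (α i)] [∀ i, LinearOrder (α i)] in
/-- The weight of a 4-tuple is invariant under the action. [this work] -/
theorem W4_actQ (w : ∀ i, α i → ℝ) (π : LPerm4 ι) (t : Fin 4 → ∀ i, α i) : W4 (prodW w) (actQ π t) = W4 (prodW w) t := by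
  simp only [W4, prodW, actQ]
  rw [Finset.prod_comm, Finset.prod_comm (s := (univ : Finset (Fin 4)))]
  refine prod_congr rfl fun i _ => ?_
  exact Equiv.prod_comp (π i) (fun j => w i (t j i))

omit [∀ i, LinearOrder (α i)] in
/-- Re-indexing the 4-tuple sum by the action. [this work] -/
theorem sum_quad_act (w : ∀ i, α i → ℝ) (F : (Fin 4 → ∀ i, α i) → ℝ) (π : LPerm4 ι) :
    ∑ t : Fin 4 → ∀ i, α i, W4 (prodW w) t * F (actQ π t) = ∑ t : Fin 4 → ∀ i, α i, W4 (prodW w) t * F t := by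
  rw [← Equiv.sum_comp (actQEquiv (α := α) π) (fun t => W4 (prodW w) t * F t)]
  refine sum_congr rfl fun t _ => ?_
  show W4 (prodW w) t * F (actQ π t) = W4 (prodW w) (actQ π t) * F (actQ π t)
  rw [W4_actQ]

omit [∀ i, LinearOrder (α i)] in
/-- **Orbit averaging** for 4-tuples. [this work] -/
theorem sum_quad_eq_sum_orbitAvg (w : ∀ i, α i → ℝ) (F : (Fin 4 → ∀ i, α i) → ℝ) :
    ∑ t : Fin 4 → ∀ i, α i, W4 (prodW w) t * F t =
      ∑ t : Fin 4 → ∀ i, α i, W4 (prodW w) t * ((∑ π : LPerm4 ι, F (actQ π t)) / Fintype.card (LPerm4 ι)) := by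
  have hN : (Fintype.card (LPerm4 ι) : ℝ) ≠ 0 := by exact_mod_cast Fintype.card_ne_zero
  have key : ∑ t : Fin 4 → ∀ i, α i, W4 (prodW w) t * (∑ π : LPerm4 ι, F (actQ π t)) =
      (Fintype.card (LPerm4 ι) : ℝ) * ∑ t : Fin 4 → ∀ i, α i, W4 (prodW w) t * F t := by
    calc ∑ t : Fin 4 → ∀ i, α i, W4 (prodW w) t * (∑ π : LPerm4 ι, F (actQ π t))
        = ∑ t : Fin 4 → ∀ i, α i, ∑ π : LPerm4 ι, W4 (prodW w) t * F (actQ π t) := by simp_rw [mul_sum]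
      _ = ∑ π : LPerm4 ι, ∑ t : Fin 4 → ∀ i, α i, W4 (prodW w) t * F (actQ π t) := sum_comm
      _ = ∑ π : LPerm4 ι, ∑ t : Fin 4 → ∀ i, α i, W4 (prodW w) t * F t := sum_congr rfl fun π _ => sum_quad_act w F π
      _ = (Fintype.card (LPerm4 ι) : ℝ) * ∑ t : Fin 4 → ∀ i, α i, W4 (prodW w) t * F t := by
          rw [sum_const, card_univ, nsmul_eq_mul]
  symm
  calc ∑ t : Fin 4 → ∀ i, α i, W4 (prodW w) t * ((∑ π : LPerm4 ι, F (actQ π t)) / Fintype.card (LPerm4 ι))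
      = (∑ t : Fin 4 → ∀ i, α i, W4 (prodW w) t * (∑ π : LPerm4 ι, F (actQ π t))) / Fintype.card (LPerm4 ι) := by
        rw [sum_div]
        exact sum_congr rfl fun t _ => by ring
    _ = ∑ t : Fin 4 → ∀ i, α i, W4 (prodW w) t * F t := by
        rw [key, mul_div_cancel_left₀ _ hN]

omit [DecidableEq ι] [∀ i, Fintype (α i)] [∀ i, LinearOrder (α i)] in
/-- The weight of a 4-tuple is nonnegative for nonnegative marginal weights. [this work] -/
theorem W4_nonneg {w : ∀ i, α i → ℝ} (hw : ∀ i x, 0 ≤ w i x) (t : Fin 4 → ∀ i, α i) : 0 ≤ W4 (prodW w) t :=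
  prod_nonneg fun _ _ => prod_nonneg fun _ _ => hw _ _

omit [∀ i, LinearOrder (α i)] in
/-- Reduction to orbit sums: if `Σ_π G₄(π·t) ≥ 0` for every 4-tuple `t`, then `E₄(1_a,1_b,1_c,1_d) ≥ 0` under a product probability
weight. [this work] -/
theorem sahiE_four_setInd_nonneg_of_orbitSum_nonneg [∀ i, DecidableEq (α i)] {w : ∀ i, α i → ℝ} (hw : ∀ i x, 0 ≤ w i x)
    (hμ : ∑ p, prodW w p = 1) (a b c d : Finset (∀ i, α i))
    (horb : ∀ t : Fin 4 → ∀ i, α i, 0 ≤ ∑ π : LPerm4 ι, Gr4 a b c d (actQ π t)) :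
    0 ≤ sahiE (prodW w) 4 ![setInd a, setInd b, setInd c, setInd d] := by
  rw [sahiE_four_setInd_eq_sum_quad _ hμ, sum_quad_eq_sum_orbitAvg]
  exact sum_nonneg fun t _ => mul_nonneg (W4_nonneg hw t) (div_nonneg (horb t) (Nat.cast_nonneg _))

/-! ## Sorting pull-back: orbit sums are order-4 Latin kernels -/

/-- The sorting permutation of axis `i` of the 4-tuple `t`. [this work] -/
def srtQ (t : Fin 4 → ∀ i, α i) (i : ι) : Equiv.Perm (Fin 4) := Tuple.sort fun j => t j i

/-- The monotone map `ψ_t : [4]^ι → Π_i α_i`. [this work] -/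
def psiQ (t : Fin 4 → ∀ i, α i) (q : Pt4 ι) : ∀ i, α i := fun i => t (srtQ t i (q i)) i

omit [Fintype ι] [DecidableEq ι] [∀ i, Fintype (α i)] in
/-- `ψ_t` is monotone. [this work] -/
theorem psiQ_monotone (t : Fin 4 → ∀ i, α i) : Monotone (psiQ t) :=
  fun _ _ h i => Tuple.monotone_sort (fun j => t j i) (h i)

/-- The pull-back of a subset along `ψ_t`. [this work] -/
def pullQ (t : Fin 4 → ∀ i, α i) (s : Finset (∀ i, α i)) : Finset (Pt4 ι) := univ.filter fun q => psiQ t q ∈ s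

omit [∀ i, Fintype (α i)] in
/-- Pull-backs of up-sets are up-sets of `[4]^ι`. [this work] -/
theorem isUpperSet_pullQ (t : Fin 4 → ∀ i, α i) {s : Finset (∀ i, α i)} (hs : IsUpperSet (s : Set (∀ i, α i))) :
    IsUpperSet ((pullQ t s : Finset (Pt4 ι)) : Set (Pt4 ι)) := by
  intro q q' hqq' hq
  rw [Finset.mem_coe, pullQ, mem_filter] at hq ⊢
  exact ⟨mem_univ _, hs (psiQ_monotone t hqq') hq.2⟩

omit [∀ i, Fintype (α i)] in
/-- Indicators pull back. [this work] -/
theorem chi_psiQ (t : Fin 4 → ∀ i, α i) (s : Finset (∀ i, α i)) (q : Pt4 ι) : chi s (psiQ t q) = chi (pullQ t s) q := by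
  simp [chi, pullQ]

omit [Fintype ι] [DecidableEq ι] [∀ i, Fintype (α i)] in
/-- The 4-tuple `(srtQ t · ρ) · t` is `ψ_t` of the Latin 4-tuple indexed by `ρ`. [this work] -/
theorem actQ_srtQ_mul (t : Fin 4 → ∀ i, α i) (ρ : LPerm4 ι) : actQ (srtQ t * ρ) t = fun j => psiQ t (lpt4 ρ j) := by
  funext j i; simp [actQ, psiQ, lpt4, Pi.mul_apply, Equiv.Perm.mul_apply]

omit [∀ i, Fintype (α i)] in
/-- **Orbit sums are order-4 Latin kernels of the pulled-back 4-tuple.** [this work] -/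
theorem orbitSum_eq_kappa4 (t : Fin 4 → ∀ i, α i) (a b c d : Finset (∀ i, α i)) :
    ∑ π : LPerm4 ι, Gr4 a b c d (actQ π t) = ((kappa4 (pullQ t a) (pullQ t b) (pullQ t c) (pullQ t d) : ℤ) : ℝ) := by
  rw [← Equiv.sum_comp (Equiv.mulLeft (srtQ t)) (fun π => Gr4 a b c d (actQ π t)), kappa4, Int.cast_sum]
  refine sum_congr rfl fun ρ _ => ?_
  rw [Equiv.coe_mulLeft, actQ_srtQ_mul, ← Gr4_eq_cast]
  simp only [Gr4, chi_psiQ]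

/-! ## Assembly -/

/-- **`E₄ ≥ 0` for four up-sets of `Π_i α_i` under a product probability weight, given FBP(4,|ι|).** [this work] -/
theorem sahiE_four_setInd_nonneg_pi (hpos : LatinPos4 ι) {w : ∀ i, α i → ℝ} (hw : ∀ i x, 0 ≤ w i x) (hμ : ∑ p, prodW w p = 1)
    {a b c d : Finset (∀ i, α i)} (ha : IsUpperSet (a : Set (∀ i, α i))) (hb : IsUpperSet (b : Set (∀ i, α i)))
    (hc : IsUpperSet (c : Set (∀ i, α i))) (hd : IsUpperSet (d : Set (∀ i, α i))) :
    0 ≤ sahiE (prodW w) 4 ![setInd a, setInd b, setInd c, setInd d] :=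
  sahiE_four_setInd_nonneg_of_orbitSum_nonneg hw hμ a b c d fun t => by
    rw [orbitSum_eq_kappa4]
    exact_mod_cast hpos _ _ _ _ ⟨isUpperSet_pullQ t ha, isUpperSet_pullQ t hb, isUpperSet_pullQ t hc, isUpperSet_pullQ t hd⟩

/-- **THEOREM (FBP(4,d) ⟹ Sahi positivity of order 4 on every product of `d` finite chains).** [this work] -/
theorem sahiPositive_four_prodW (hpos : LatinPos4 ι) (w : ∀ i, α i → ℝ) (hw : ∀ i x, 0 ≤ w i x) (hμ : ∑ p, prodW w p = 1) :
    SahiPositive (prodW w) 4 := by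
  rw [sahiPositive_iff_indicators]
  intro U hU
  have hf : (fun i => setInd (U i)) = ![setInd (U 0), setInd (U 1), setInd (U 2), setInd (U 3)] := by
    funext i; fin_cases i <;> rfl
  rw [hf]
  exact sahiE_four_setInd_nonneg_pi hpos hw hμ (hU 0) (hU 1) (hU 2) (hU 3)

/-- **THEOREM, marginal form.**  Given FBP(4,|ι|): for probability weights `w_i` on finite linear orders `α_i`, the product weight
`p ↦ Π_i w_i(p_i)` on `Π_i α_i` is Sahi-positive of order `4`. [this work] -/
theorem sahiPositive_four_prodW' (hpos : LatinPos4 ι) (w : ∀ i, α i → ℝ) (hw : ∀ i x, 0 ≤ w i x) (hw1 : ∀ i, ∑ x, w i x = 1) :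
    SahiPositive (fun p : (∀ i, α i) => ∏ i, w i (p i)) 4 :=
  sahiPositive_four_prodW hpos w hw (sum_prodW_eq_one hw1)

/-- **THEOREM (the `n = 4` rung, assembled).**  If FBP(3,|ι|) holds (`LatinPos ι`) and `K₄ ≥ 0` on the TERMINAL up-set 4-tuples of
`[4]^ι` (`TerminalPos4 ι`, a finite check), then Sahi's `E₄(f₁,f₂,f₃,f₄) ≥ 0` for all nonnegative monotone `fᵢ` on `Π_i α_i` under every
product probability weight. [this work] -/
theorem sahiPositive_four_of_terminalPos4 (hpos : LatinPos ι) (hT : TerminalPos4 ι) (w : ∀ i, α i → ℝ) (hw : ∀ i x, 0 ≤ w i x)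
    (hw1 : ∀ i, ∑ x, w i x = 1) : SahiPositive (fun p : (∀ i, α i) => ∏ i, w i (p i)) 4 :=
  sahiPositive_four_prodW' ((latinPos4_iff_terminalPos4 hpos).2 hT) w hw hw1

end Pi4

end Summit.CriticalPhenomena.PercolationContinuityZ3.Theorems.SahiLatin
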